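import Literature.NumberTheory.Rogawski1990.ArchBouazizClassDescentG      -- ★ p852014 (F0P3a-p04 (g27)) F6a: `exists_classDescentG_of_section_of_descent` (`Cov`-parametric)
import Literature.NumberTheory.Rogawski1990.ArchBouazizChartDescentG      -- ★ p852010 (F0P3a-p04 (g27)) F6b: `div_eq_div_of_bzClassMapG_eq` (fibres ⇒ quotient invariance)
import Literature.NumberTheory.Rogawski1990.ArchBouazizClassMapSectionG   -- ★ p852021 (LH10-p02 (g9)) F3: `exists_contDiffOn_section_bzClassMapG₃`
import HarnessLib

/-!
# (Σ4c-G) PAID — the based one-chart DESCENT through the `G`-side class map at a regular chart point, hypothesis-free at `(S′, c₀, Φ)` (Bouaziz 1994 §5.1; Varadarajan 1989 §6.4)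

Topic `NumberTheory/Rogawski1990`; namespace `Literature.NumberTheory.Rogawski1990`.  THEOREMS ONLY (no `def`, no instance, no notation, no axiom, no named fact, no `sorry`).
Cell `pub/hodgecm-mathlib`, crux H413 (`stmt-HodgeConjecture-24833`), road «N8-INNER» (owner LH2-plan (g1), RULING (7) 2026-09-02T15:59Z), brick **(7) «(Σ-REG-G)» FILE F6c
«DESCENT PAID»** — the `G`-twin of ★ `exists_classDescent` (`ArchBouazizClassDescentPaid`, LH10-p02 (g7), p851569): ★ F6a `exists_classDescentG_of_section_of_descent` (p852014) with
its two inputs discharged BY NAME — (sec) ★ F3 `exists_contDiffOn_section_bzClassMapG₃` (p852021: a `C^∞` local section of `bzClassMapG S′` at a regular chart point, three cubic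
root branches ★ p851986∕p851971) and (desc) ★ F6b `div_eq_div_of_bzClassMapG_eq` (p852010: on the fibres of `bzClassMapG S′` — partner permutations, `2π`-shifts, `x ↦ −x` — the
quotient `Ψ∕Φ` of two (P)(W^st)(X)-covariant functionals is constant) — at the covariance class `Cov := (P)_{S′} ∧ (W^st)_{S′} ∧ (X)_{S′}`.  Author LH3-p04 (g7).  Count-neutral.

THE HEAD **`exists_classDescentG (S′) (hc₀ : c₀ ∈ RegG S′) (Φ) (hε₀) (hΦP) (hΦW) (hΦX) (hΦs : ContDiffOn ℝ ∞ Φ (StInRegG S′)) (hΦ0)`**: `∃ ε ∈ (0, ε₀], ∀ Ψ, (P)_{S′} → (W^st)_{S′} →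
(X)_{S′} → ContDiffOn ℝ ∞ Ψ (StInRegG S′) → ∃ F ∈ C^∞, ∀ c ∈ RegG S′, dist (bzClassMapG S′ c) (bzClassMapG S′ c₀) < ε → F (bzClassMapG S′ c) · Φ c = Ψ c` — the `hdesc` input of the
(Σ-REG-G) assembly (banked ROAD A′ file `ArchBouazizRegularGermsG`, `bzLocalSurjRegularG_of_parts`) and of the ROAD B «REGULAR EP GENERATOR» (one-place reading `= h ∘ cl_w`) TOKEN
FOR TOKEN.  Plus the slot-bound convenience form `exists_classDescentG_of_slotBound` (non-vanishing of `Φ` given on bounded noncompact slots, ★ F5's shape, via ★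
`classDescentG_nonvanishing_of_slotBound`).
HONEST LABEL: HC_CM is proved only modulo the 7 printed citations (2 remaining: hLiu418 = stmt-HodgeConjecture-24832, h413 = stmt-HodgeConjecture-24833) until rung 0 closes; this
file pays the (Σ4c-G) input only (count-neutral).

## References
* [Bouaziz1994IntegralesOrbitales] A. Bouaziz, *Intégrales orbitales sur les groupes de Lie réductifs*, Ann. Sci. ÉNS (4) 27 (1994) 573–609, §5.1 p. 588.
* [Varadarajan1989] V. S. Varadarajan, *An Introduction to Harmonic Analysis on Semisimple Lie Groups*, Cambridge Stud. Adv. Math. 16 (1989), §6.4 Thms. 22–23.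
-/

set_option autoImplicit false

noncomputable section

open Complex Set Function Real Filter Topology Metric
open scoped ContDiff
open Literature.NumberTheory.Automorphic.ArchCartan

namespace Literature.NumberTheory.Rogawski1990

section Paid

variable {W : Type*} [Fintype W] [DecidableEq W]

/-- **(Σ4c-G) PAID — DESCENT THROUGH THE `G`-CLASS MAP AT A REGULAR CHART POINT**: `S′` a chart, `c₀ ∈ RegG S′`, `Φ` a (P)(W^st)(X)-covariant single-chart functional smooth on
`StInRegG S′` and non-zero at the regular points whose class is `ε₀`-close to `bzClassMapG S′ c₀`.  Then there is `ε ∈ (0, ε₀]` such that EVERY (P)(W^st)(X)-covariant `Ψ` smooth on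
`StInRegG S′` descends near the base class: `∃ F ∈ C^∞(W → ℂ × ℂ × ℂ)`, `F (bzClassMapG S′ c) · Φ c = Ψ c` for `c ∈ RegG S′`, `dist (bzClassMapG S′ c) (bzClassMapG S′ c₀) < ε`
(★ F6a over ★ F3's section and ★ F6b's quotient invariance). [cite: Bouaziz1994IntegralesOrbitales, §5.1 p. 588] [cite: Varadarajan1989, §6.4 Thms. 22–23] -/
theorem exists_classDescentG (S' : Finset W) {c₀ : W → Fin 3 → ℝ} (hc₀ : c₀ ∈ RegG S') (Φ : (W → Fin 3 → ℝ) → ℂ) {ε₀ : ℝ} (hε₀ : 0 < ε₀)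
    (hΦP : ∀ (c : W → Fin 3 → ℝ) (w : W) (i : Fin 3) (k : ℤ), (w ∉ S' ∨ i ≠ 0) → Φ (c + angleShift w i k) = Φ c)
    (hΦW : ∀ (c : W → Fin 3 → ℝ) (w : W) (i j : Fin 3), w ∉ S' → i ≠ j → Φ (hcSwapAt w i j c) * archRG S' c = archRG S' (hcSwapAt w i j c) * Φ c)
    (hΦX : ∀ (c : W → Fin 3 → ℝ) (w : W), w ∈ S' → Φ (negXAt w c) = Φ c)
    (hΦs : ContDiffOn ℝ ∞ Φ (StInRegG S')) (hΦ0 : ∀ c ∈ RegG S', dist (bzClassMapG S' c) (bzClassMapG S' c₀) < ε₀ → Φ c ≠ 0) :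
    ∃ ε : ℝ, 0 < ε ∧ ε ≤ ε₀ ∧ ∀ Ψ : (W → Fin 3 → ℝ) → ℂ,
      (∀ (c : W → Fin 3 → ℝ) (w : W) (i : Fin 3) (k : ℤ), (w ∉ S' ∨ i ≠ 0) → Ψ (c + angleShift w i k) = Ψ c) →
      (∀ (c : W → Fin 3 → ℝ) (w : W) (i j : Fin 3), w ∉ S' → i ≠ j → Ψ (hcSwapAt w i j c) * archRG S' c = archRG S' (hcSwapAt w i j c) * Ψ c) →
      (∀ (c : W → Fin 3 → ℝ) (w : W), w ∈ S' → Ψ (negXAt w c) = Ψ c) →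
      ContDiffOn ℝ ∞ Ψ (StInRegG S') →
        ∃ F : (W → ℂ × ℂ × ℂ) → ℂ, ContDiff ℝ ∞ F ∧ ∀ c ∈ RegG S', dist (bzClassMapG S' c) (bzClassMapG S' c₀) < ε → F (bzClassMapG S' c) * Φ c = Ψ c := by
  -- the covariance class (P)_{S′} ∧ (W^st)_{S′} ∧ (X)_{S′}, read by ★ F6a as a parameter
  obtain ⟨ε, hε, hεε₀, hF⟩ := exists_classDescentG_of_section_of_descent S' hc₀ Φ hε₀ hΦs hΦ0 (exists_contDiffOn_section_bzClassMapG₃ S' hc₀)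
    (fun Ψ : (W → Fin 3 → ℝ) → ℂ =>
      (∀ (c : W → Fin 3 → ℝ) (w : W) (i : Fin 3) (k : ℤ), (w ∉ S' ∨ i ≠ 0) → Ψ (c + angleShift w i k) = Ψ c) ∧
      (∀ (c : W → Fin 3 → ℝ) (w : W) (i j : Fin 3), w ∉ S' → i ≠ j → Ψ (hcSwapAt w i j c) * archRG S' c = archRG S' (hcSwapAt w i j c) * Ψ c) ∧
      (∀ (c : W → Fin 3 → ℝ) (w : W), w ∈ S' → Ψ (negXAt w c) = Ψ c))
    (fun Ψ hΨ _ _ hc hc' h hΦ => div_eq_div_of_bzClassMapG_eq S' hΨ.1 hΨ.2.1 hΨ.2.2 hΦP hΦW hΦX hc hc' h hΦ)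
  exact ⟨ε, hε, hεε₀, fun Ψ hΨP hΨW hΨX hΨs => hF Ψ ⟨hΨP, hΨW, hΨX⟩ hΨs⟩

/-- **The same with `Φ` non-vanishing on bounded noncompact slots** (★ F5's shape `∀ c ∈ RegG S′, (∀ w ∈ S′, |c w 0| ≤ R) → Φ c ≠ 0`) and the slot bound valid `ε₀`-close to the base
class (★ F1 (g4)): the composition with ★ `classDescentG_nonvanishing_of_slotBound`. [cite: Bouaziz1994IntegralesOrbitales, §5.1 p. 588] -/
theorem exists_classDescentG_of_slotBound (S' : Finset W) {c₀ : W → Fin 3 → ℝ} (hc₀ : c₀ ∈ RegG S') (Φ : (W → Fin 3 → ℝ) → ℂ) {ε₀ R : ℝ} (hε₀ : 0 < ε₀)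
    (hΦP : ∀ (c : W → Fin 3 → ℝ) (w : W) (i : Fin 3) (k : ℤ), (w ∉ S' ∨ i ≠ 0) → Φ (c + angleShift w i k) = Φ c)
    (hΦW : ∀ (c : W → Fin 3 → ℝ) (w : W) (i j : Fin 3), w ∉ S' → i ≠ j → Φ (hcSwapAt w i j c) * archRG S' c = archRG S' (hcSwapAt w i j c) * Φ c)
    (hΦX : ∀ (c : W → Fin 3 → ℝ) (w : W), w ∈ S' → Φ (negXAt w c) = Φ c)
    (hΦs : ContDiffOn ℝ ∞ Φ (StInRegG S'))
    (hΦR : ∀ c ∈ RegG S', (∀ w, w ∈ S' → |c w 0| ≤ R) → Φ c ≠ 0)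
    (hxbd : ∀ c : W → Fin 3 → ℝ, dist (bzClassMapG S' c) (bzClassMapG S' c₀) < ε₀ → ∀ w, w ∈ S' → |c w 0| ≤ R) :
    ∃ ε : ℝ, 0 < ε ∧ ε ≤ ε₀ ∧ ∀ Ψ : (W → Fin 3 → ℝ) → ℂ,
      (∀ (c : W → Fin 3 → ℝ) (w : W) (i : Fin 3) (k : ℤ), (w ∉ S' ∨ i ≠ 0) → Ψ (c + angleShift w i k) = Ψ c) →
      (∀ (c : W → Fin 3 → ℝ) (w : W) (i j : Fin 3), w ∉ S' → i ≠ j → Ψ (hcSwapAt w i j c) * archRG S' c = archRG S' (hcSwapAt w i j c) * Ψ c) →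
      (∀ (c : W → Fin 3 → ℝ) (w : W), w ∈ S' → Ψ (negXAt w c) = Ψ c) →
      ContDiffOn ℝ ∞ Ψ (StInRegG S') →
        ∃ F : (W → ℂ × ℂ × ℂ) → ℂ, ContDiff ℝ ∞ F ∧ ∀ c ∈ RegG S', dist (bzClassMapG S' c) (bzClassMapG S' c₀) < ε → F (bzClassMapG S' c) * Φ c = Ψ c :=
  exists_classDescentG S' hc₀ Φ hε₀ hΦP hΦW hΦX hΦs (classDescentG_nonvanishing_of_slotBound S' c₀ Φ hΦR hxbd)

end Paid

end Literature.NumberTheory.Rogawski1990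

end
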